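import Summits.CriticalPhenomena.Ising3DConformalLimit.Theses.HyperoctahedralRP
import Summits.CriticalPhenomena.Ising3DConformalLimit.Theorems.HyperoctahedralRPExistsScaleCovariantLimitDecimationPathLipschitzGivesCrux
import HarnessLib

/-!
# Skeleton — crux `ExistsScaleCovariantLimit` (item stmt-CriticalPhenomena-1981), line `decimation-homotopy-rate` — v6 (lead c10)

Crux-plan of the crux idea `decimation-homotopy-rate` (ideator 4, round 2; triage r2-1/r2-2/r2-3: pass ×3), route
`HyperoctahedralRP` (decl shared verbatim by 13 further routes). Planner `planner-cruxplan-stmt-CriticalPhenomena-1981-decimation-homotopy--0`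
(v1, 2026-08-16T21:2xZ); lead `prover-line-stmt-CriticalPhenomena-1981-c8-0` (v2–v4, 2026-08-16T22:2x–23:1xZ);
lead `prover-line-stmt-CriticalPhenomena-1981-c9-0` (v5, 2026-08-16T23:3xZ: stubs unchanged, re-registered; held stub P₂, worker on P₃);
lead `prover-line-stmt-CriticalPhenomena-1981-c10-0` (v6, 2026-08-16T23:5xZ: stubs unchanged, re-registered; held stub P₂; line verdict this seat).

## State (v6 = v4 re-registered by leads c9, c10): COMPLETE MODULO THE ENGINE — sorries = `stub_pathLipschitz2`, `stub_pathLipschitz3` only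

Everything else is LANDED and imported through `Theorems/HyperoctahedralRPExistsScaleCovariantLimitDecimationPathLipschitzGivesCrux.lean`:
* Defs p129337 `…DecimationDefs` — vocabulary (two-coupling `K`/`J` ferromagnet on free boxes `boxAvg`, `subPair`, `Jcrit`, `finZoom`,
  `latticeZoom`), statements (`EndpointIdentity` [all volumes], `BoxBridge`, `FreeBoxLimit`, `CurveEndpoints`, `PathLipschitz`,
  `NNEndTangentBound`), the five `Sig.stub_*`;
* E p130071 `…DecimationEndpointIdentity` (`stub_endpointIdentity`), B p129928 `…DecimationBoxBridge` (`stub_boxBridge`),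
  C p129855 `…DecimationCurveEndpoints` (`stub_curveEndpoints`) — wave 1 of stub-workers;
* tail p130196 `…DecimationPathLipschitzGivesCrux` — `freeBoxLimit_holds`, `curveEndpoints_holds`, `meshRate`, `hierarchy_of_stubs`,
  `twoPointDoubling_of_pathLipschitz2` (P₂ ⟹ item 6150), `orbitPrecompact_of_pathLipschitz2` (⟹ 5955),
  **`ExistsScaleCovariantLimit_of_pathLipschitz : PathLipschitz 2 → PathLipschitz 3 → crux`**;
* minimal inputs p130473/p130728 `…DecimationMeshRateGivesCrux` — what the composition CONSUMES of `PathLipschitz p` is the endpoint pair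
  only, i.e. the MESH RATE of the critical n.n. model `|latticeZoom n (pL) z − latticeZoom n L z| ≤ B·L^{-θ}`:
  `ExistsScaleCovariantLimit_of_meshRates` (p = 2, 3), `_of_summableMeshDifferences`, `_of_endpointRates`, `_of_summableIntMeshDifferences`
  (ONE family: summable `|Z(m+1;z) − Z(m;z)|`), `_of_intMeshRate`, `twoPointDoubling_of_meshRate2`;
* scaffolding of the engine: p130454 `…DecimationTwoCouplingGKS` (GKS I/II, volume monotonicity, free state exists, `tendsto_subPair`),
  p130572 `…DecimationCriticalCurveBasic` (`0 ≤ Jcrit ≤ β_c`, `Jcrit_antitoneOn`), p130695 `…DecimationNormalisationPos`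
  (`boxAvg_normalisation_pos`: `finZoom`'s pinned normalisation is > 0 along the curve — no junk).

## The line in one paragraph (planner)

DO NOT DECIMATE — HOMOTOPE. On `ℤ³` take the two-coupling ferromagnet with nearest-neighbour coupling `K` and range-`p` axis
coupling `J` between the sites of the sublattice `pℤ³` only, free boundary condition on the boxes `Λ_N`. At `(K,J) = (β_c, 0)` it
IS the critical n.n. model; at `(0, β_c)` the sublattice spins ARE the critical n.n. model on `pℤ³ ≅ ℤ³` (E). Along the
susceptibility critical curve `J = J_χ(K)` the PINNED SUBLATTICE ZOOM `finZoom` is conjectured to move by at most `C·L^{-θ}` per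
unit `ℓ¹`-length of the curve (`PathLipschitz p` — LOCAL UNIVERSALITY WITH A RATE). Its two endpoints are the pinned zoom of the
critical n.n. model at the integer meshes `1/(pL)` and `1/L`, so `|Z(pL; z) − Z(L; z)| ≤ B L^{-θ}` (`meshRate`), geometric
summation gives convergence along `p^k`, and for `p = 2` AND `p = 3` this is the residue S2' ∧ S3' of the dead line `Sketch`,
which the landed `TwoHierarchies.crux_iff_dyadicInt_triadicInt` (p123864) turns into the crux BY NAME.

Disproof.lean v8 (2026-08-16T04:19Z) read at start and at every turn boundary of the lead's cycle: unchanged, §F Targets none, no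
`_false_without_` theorem; §E (`W_ε`) is consistent with MeshRate 2 alone and violates MeshRate 3 jointly — any engine must treat the
second prime genuinely. Dossier for the planner: `Cruxes/ExistsScaleCovariantLimit/PROMOTION-PL.md`; line card: `Lines/decimation-homotopy-rate.md`.
-/

noncomputable section

open Filter Topology
open scoped BigOperators
open Literature.Probability.LatticeModels
open Summit.CriticalPhenomena.Ising3DConformalLimit.MoebiusLimitExistsOnlyInteraction (rhoPin)
open Summit.CriticalPhenomena.Ising3DConformalLimit.Theses
open Classical

namespace Summit.CriticalPhenomena.Ising3DConformalLimit.Cruxes.ExistsScaleCovariantLimit.DecimationHomotopyRate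

/-! ## §0–§2: see the imported definitions module (vocabulary, statements, `Sig.stub_*`) -/

/-! ### Registered stubs

E `stub_endpointIdentity` (p130071), B `stub_boxBridge` (p129928) and C `stub_curveEndpoints` (p129855) are LANDED theorems (imported,
same namespace). The ONLY sorries of this file are the two load-bearing research stubs P₂/P₃ (conjecture `PathLipschitz 2 / 3`). -/

/-- **P₂ — path Lipschitz for `p = 2`** (LOAD-BEARING; dyadic hierarchy; with E, B, C it already yields
the dead line's S2', hence items 6150 `TwoPointDoubling` and 5955 `OrbitPrecompact` by p123864/p120504). -/
theorem stub_pathLipschitz2 : Sig.stub_pathLipschitz2 := by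
  sorry

/-- **P₃ — path Lipschitz for `p = 3`** (LOAD-BEARING; triadic hierarchy = the dead line's S3'). -/
theorem stub_pathLipschitz3 : Sig.stub_pathLipschitz3 := by
  sorry

/-! ## §4 Composition — the crux BY NAME from the five stubs -/

/-- **COMPOSITION.** `Sig.stub_endpointIdentity → Sig.stub_boxBridge → Sig.stub_curveEndpoints →
Sig.stub_pathLipschitz2 → Sig.stub_pathLipschitz3 → ExistsScaleCovariantLimit`: the bridge gives `FreeBoxLimit`
(`freeBoxLimit_of_bridge`), E and B give the curve endpoints (stub C), the two hierarchies `p = 2`, `p = 3`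
(`hierarchy_of_stubs`) are the dead line's residue S2' ∧ S3', and the LANDED
`TwoHierarchies.crux_iff_dyadicInt_triadicInt` (p123864; two hierarchies force the filter, compactness included)
is the whole tail. Sorry-free given the stubs; concludes
`Summit.CriticalPhenomena.Ising3DConformalLimit.Theses.HyperoctahedralRP.ExistsScaleCovariantLimit` by name. -/
theorem ExistsScaleCovariantLimit_of :
    Sig.stub_endpointIdentity → Sig.stub_boxBridge → Sig.stub_curveEndpoints →
      Sig.stub_pathLipschitz2 → Sig.stub_pathLipschitz3 →
      Summit.CriticalPhenomena.Ising3DConformalLimit.Theses.HyperoctahedralRP.ExistsScaleCovariantLimit :=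
  fun _ _ _ hP2 hP3 => ExistsScaleCovariantLimit_of_pathLipschitz hP2 hP3

/-- The crux from the registered stubs (closed modulo exactly `stub_endpointIdentity`, `stub_boxBridge`,
`stub_curveEndpoints`, `stub_pathLipschitz2`, `stub_pathLipschitz3`). -/
theorem ExistsScaleCovariantLimit_proof :
    Summit.CriticalPhenomena.Ising3DConformalLimit.Theses.HyperoctahedralRP.ExistsScaleCovariantLimit :=
  ExistsScaleCovariantLimit_of stub_endpointIdentity stub_boxBridge stub_curveEndpoints
    stub_pathLipschitz2 stub_pathLipschitz3

end Summit.CriticalPhenomena.Ising3DConformalLimit.Cruxes.ExistsScaleCovariantLimit.DecimationHomotopyRate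

end
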